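import Mathlib
import HarnessLib
import Summits.HubbardSuperconductivity.HubbardSuperconductivity.Theorems.KLProgrammeThinLevelSetLocal
import Summits.HubbardSuperconductivity.HubbardSuperconductivity.Theorems.KLProgrammeThinLevelSetGraphChart

/-!
# Route `KLProgramme` — K3 engine (stmt-HubbardSuperconductivity-20437), stub (b) (ℓ)/(I2)–(I3), located item «ABS-UMK-COUNT» / «UV-REMEASURE-COUNT»:
# lattice points in thin level sets, part 8 — the ANCHORED TRIPLE COUNT (third leg eliminated by the linear tangential constraint)

Cell gate-hubbard-kl, seat p4 g15 (route HOME/prover-p4/UV-REMEASURE-COUNT.md §5, steps (3)–(4)).  After the graph chart (parts 6–7) and the slicing of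
all free legs but three of equal sign, the three kept legs carry tangential coordinates `a, b, c` from an `h`-separated finite set `G ⊂ [−ρ₀, ρ₀]` (the
chart images of the sector centres in the cone) subject to the two conservation windows
`|a + b + c − τ| ≤ δ_t` (tangential, LINEAR) and `|f(a) + f(b) + f(c) − β| ≤ δ_n` (normal).  This file counts such triples:

* `card_le_of_separated_subset_Icc` — one-dimensional packing: an `h`-separated finite subset of `[a, b]` has `≤ (b − a)/h + 1` elements;
* **`card_tripleWindow_le`** — `#{(a,b,c) ∈ G³ : both windows} ≤ (2δ_t/h + 1) · 960A(2(δ_n + Bδ_t) + (4B+1)h)/(c²h²)`: for each pair `(a, b)` the third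
  coordinate is confined to an interval of length `2δ_t` (`≤ 2δ_t/h + 1` choices), and the pair lies in the thin level window
  `|f(a) + f(b) + f(τ − a − b) − β| ≤ δ_n + Bδ_t` of the symmetric triple sum (`f` is `B`-Lipschitz), counted by `card_mul_sq_le_tripleSum_local` (part 5);
  the chart is needed on `[−Λ, Λ]` with `Λ ≥ 6ρ₀ + 3δ_t + 2h`.

With `δ_t, δ_n = O(L·w′)`, `h ≍ w′ = 2^{−n′}π` this is `O(L²·2^{n′})` triples — one factor `2^{n′}` for three legs, i.e. the `(L−3)` law after slicing.
Everything is PROVED; no definitions, no named facts; generic calculus. [folklore]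
-/

noncomputable section

open Real Set Metric

namespace Summit.HubbardSuperconductivity.HubbardSuperconductivity.Theorems.ThinLevelSet

set_option linter.dupNamespace false -- summit = problem name (single-conjunct summit), D-0017

/-! ## §1 One-dimensional packing -/

/-- **One-dimensional packing**: a finite set of reals in `[a, b]` (`a ≤ b`) whose distinct points are at mutual distance `≥ h > 0` has at most
`(b − a)/h + 1` elements (the map `x ↦ ⌊(x − a)/h⌋` is injective into `{0, …, ⌊(b − a)/h⌋}`). [folklore] -/
theorem card_le_of_separated_subset_Icc {h a b : ℝ} (hh : 0 < h) (hab : a ≤ b) (S : Finset ℝ)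
    (hS : ∀ x ∈ S, x ∈ Icc a b) (hsep : ∀ x ∈ S, ∀ y ∈ S, x ≠ y → h ≤ |x - y|) :
    (S.card : ℝ) ≤ (b - a) / h + 1 := by
  classical
  set φ : ℝ → ℤ := fun x => ⌊(x - a) / h⌋ with hφ
  -- strict growth of `φ` along `S`
  have hlt : ∀ x ∈ S, ∀ y ∈ S, x < y → φ x < φ y := by
    intro x hx y hy hxy
    have hd : h ≤ y - x := by
      have := hsep x hx y hy hxy.ne
      rwa [abs_sub_comm, abs_of_pos (sub_pos.2 hxy)] at this
    have h1 : (x - a) / h + 1 ≤ (y - a) / h := by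
      rw [div_add_one hh.ne', div_le_div_iff_of_pos_right hh]; linarith
    have h2 : φ x + 1 ≤ φ y := by
      rw [hφ]; simp only
      have := Int.floor_le_floor h1
      rwa [Int.floor_add_one] at this
    omega
  have hinj : Set.InjOn φ S := by
    intro x hx y hy hxy
    by_contra hne
    rcases lt_or_gt_of_ne hne with h | h
    · exact absurd hxy (hlt x hx y hy h).ne
    · exact absurd hxy (hlt y hy x hx h).ne'
  have hmaps : Set.MapsTo φ S (Finset.Icc (0 : ℤ) ⌊(b - a) / h⌋) := by
    intro x hx
    have hxS : x ∈ S := by simpa using hx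
    obtain ⟨hxa, hxb⟩ := hS x hxS
    rw [Finset.coe_Icc]
    refine ⟨Int.floor_nonneg.2 (div_nonneg (by linarith) hh.le), Int.floor_le_floor ?_⟩
    exact div_le_div_of_nonneg_right (by linarith) hh.le
  have hcard := Finset.card_le_card_of_injOn φ hmaps hinj
  rw [Int.card_Icc] at hcard
  have hq : 0 ≤ (b - a) / h := div_nonneg (by linarith) hh.le
  have hfl : (0 : ℤ) ≤ ⌊(b - a) / h⌋ := Int.floor_nonneg.2 hq
  have h1 : ((⌊(b - a) / h⌋ + 1 - 0).toNat : ℤ) = ⌊(b - a) / h⌋ + 1 := by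
    rw [Int.toNat_of_nonneg (by omega)]; ring
  have h2 : (S.card : ℤ) ≤ ⌊(b - a) / h⌋ + 1 := by
    have : (S.card : ℤ) ≤ ((⌊(b - a) / h⌋ + 1 - 0).toNat : ℤ) := by exact_mod_cast hcard
    rwa [h1] at this
  have h3 : ((S.card : ℤ) : ℝ) ≤ ((⌊(b - a) / h⌋ + 1 : ℤ) : ℝ) := by exact_mod_cast h2
  have h4 : ((⌊(b - a) / h⌋ : ℤ) : ℝ) ≤ (b - a) / h := Int.floor_le _
  push_cast at h3
  linarith

/-! ## §2 The anchored triple count -/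

/-- The embedding of a pair of reals as a point of `Fin 2 → ℝ` is injective. [folklore] -/
theorem injective_pairVec : Function.Injective (fun p : ℝ × ℝ => (![p.1, p.2] : Fin 2 → ℝ)) := by
  intro p q hpq
  have h0 := congrFun hpq 0
  have h1 := congrFun hpq 1
  simp only [Matrix.cons_val_zero, Matrix.cons_val_one] at h0 h1
  exact Prod.ext h0 h1

open Classical in
/-- **The anchored triple count.**  Let `f` be measurable, twice differentiable at the points of `[−Λ, Λ]` with `c ≤ f″ ≤ A` (`0 < c ≤ A`) and
`|f′| ≤ B` there; let `G` be a finite set of reals in `[−ρ₀, ρ₀]` with distinct points at distance `≥ h > 0`; let `δ_t, δ_n ≥ 0` and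
`Λ ≥ 6ρ₀ + 3δ_t + 2h`.  Then for every `τ, β` the number of triples `(a, b, c) ∈ G³` with `|a + b + c − τ| ≤ δ_t` and `|f a + f b + f c − β| ≤ δ_n` is
at most `(2δ_t/h + 1) · (960·A·(2(δ_n + B·δ_t) + (4B + 1)h)/c²/h²)`. [folklore] -/
theorem card_tripleWindow_le {f f' f'' : ℝ → ℝ} (hfm : Measurable f) {ρ₀ Λ c A B h δt δn : ℝ}
    (hρ₀ : 0 ≤ ρ₀) (hh : 0 < h) (hc : 0 < c) (hcA : c ≤ A) (hB : 0 ≤ B) (hδt : 0 ≤ δt) (hδn : 0 ≤ δn)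
    (hΛ : 6 * ρ₀ + 3 * δt + 2 * h ≤ Λ)
    (hf : ∀ u ∈ Icc (-Λ) Λ, HasDerivAt f (f' u) u) (hf' : ∀ u ∈ Icc (-Λ) Λ, HasDerivAt f' (f'' u) u)
    (hfloor : ∀ u ∈ Icc (-Λ) Λ, c ≤ f'' u) (hceil : ∀ u ∈ Icc (-Λ) Λ, f'' u ≤ A) (hder : ∀ u ∈ Icc (-Λ) Λ, |f' u| ≤ B)
    (G : Finset ℝ) (hG : ∀ g ∈ G, |g| ≤ ρ₀) (hsep : ∀ g ∈ G, ∀ g' ∈ G, g ≠ g' → h ≤ |g - g'|) (τ β : ℝ) :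
    ((((G ×ˢ G) ×ˢ G).filter fun t : (ℝ × ℝ) × ℝ =>
        |t.1.1 + t.1.2 + t.2 - τ| ≤ δt ∧ |f t.1.1 + f t.1.2 + f t.2 - β| ≤ δn).card : ℝ) ≤
      (2 * δt / h + 1) * (960 * A * (2 * (δn + B * δt) + (4 * B + 1) * h) / c ^ 2 / h ^ 2) := by
  set T := ((G ×ˢ G) ×ˢ G).filter fun t : (ℝ × ℝ) × ℝ =>
      |t.1.1 + t.1.2 + t.2 - τ| ≤ δt ∧ |f t.1.1 + f t.1.2 + f t.2 - β| ≤ δn with hT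
  set δ' := δn + B * δt with hδ'
  have hδ'0 : 0 ≤ δ' := by rw [hδ']; positivity
  have hA : 0 < A := hc.trans_le hcA
  -- the right-hand side is nonnegative
  have hRHS : 0 ≤ (2 * δt / h + 1) * (960 * A * (2 * (δn + B * δt) + (4 * B + 1) * h) / c ^ 2 / h ^ 2) := by positivity
  -- `f` is `B`-Lipschitz on `[−Λ, Λ]`
  have hLip := abs_sub_le_mul_abs_sub_of_hasDerivAt_le hf hder
  -- members of `G` and nearby points lie in `[−Λ, Λ]`
  have hGabs : ∀ g ∈ G, -ρ₀ ≤ g ∧ g ≤ ρ₀ := fun g hg => abs_le.1 (hG g hg)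
  by_cases hτ : |τ| ≤ 3 * ρ₀ + δt
  swap
  · -- degenerate case: no triple at all
    have hTe : T = ∅ := by
      rw [Finset.eq_empty_iff_forall_notMem]
      rintro ⟨⟨a, b⟩, g⟩ ht
      rw [hT, Finset.mem_filter, Finset.mem_product, Finset.mem_product] at ht
      obtain ⟨⟨⟨ha, hb⟩, hg⟩, h1, -⟩ := ht
      simp only at ha hb hg h1
      obtain ⟨ha1, ha2⟩ := hGabs a ha
      obtain ⟨hb1, hb2⟩ := hGabs b hb
      obtain ⟨hg1, hg2⟩ := hGabs g hg
      have h1' := abs_le.1 h1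
      exact hτ (abs_le.2 ⟨by linarith, by linarith⟩)
    rw [hTe, Finset.card_empty, Nat.cast_zero]
    exact hRHS
  -- main case: `|τ| ≤ 3ρ₀ + δ_t`
  have hτ' := abs_le.1 hτ
  set W := (G ×ˢ G).filter fun p : ℝ × ℝ => |f p.1 + f p.2 + f (τ - p.1 - p.2) - β| ≤ δ' with hW
  set C : ℝ × ℝ → Finset ℝ := fun p => G.filter fun g => |p.1 + p.2 + g - τ| ≤ δt with hC
  -- every triple projects to a pair of `W` with third coordinate in `C`
  have hsub : T ⊆ W.biUnion fun p => (C p).image fun g => (p, g) := by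
    rintro ⟨⟨a, b⟩, g⟩ ht
    rw [hT, Finset.mem_filter, Finset.mem_product, Finset.mem_product] at ht
    obtain ⟨⟨⟨ha, hb⟩, hg⟩, h1, h2⟩ := ht
    simp only at ha hb hg h1 h2
    rw [Finset.mem_biUnion]
    refine ⟨(a, b), ?_, ?_⟩
    · rw [hW, Finset.mem_filter, Finset.mem_product]
      refine ⟨⟨ha, hb⟩, ?_⟩
      simp only
      obtain ⟨hg1, hg2⟩ := hGabs g hg
      have h1' := abs_le.1 h1
      have hgI : g ∈ Icc (-Λ) Λ := ⟨by linarith, by linarith⟩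
      have hτI : τ - a - b ∈ Icc (-Λ) Λ := ⟨by linarith, by linarith⟩
      have hL := hLip g hgI (τ - a - b) hτI
      have hd : |τ - a - b - g| ≤ δt := by
        rw [abs_le]; constructor <;> linarith
      have hL' : |f (τ - a - b) - f g| ≤ B * δt :=
        hL.trans (mul_le_mul_of_nonneg_left hd hB)
      have hsplit : f a + f b + f (τ - a - b) - β = (f a + f b + f g - β) + (f (τ - a - b) - f g) := by ring
      rw [hsplit, hδ']
      exact (abs_add_le _ _).trans (add_le_add h2 hL')
    · rw [Finset.mem_image]
      refine ⟨g, ?_, rfl⟩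
      rw [hC, Finset.mem_filter]
      exact ⟨hg, h1⟩
  -- the third coordinate: at most `2δ_t/h + 1` choices
  have hCcard : ∀ p : ℝ × ℝ, (((C p).image fun g => (p, g)).card : ℝ) ≤ 2 * δt / h + 1 := by
    intro p
    have hinj : Function.Injective fun g : ℝ => (p, g) := fun x y hxy => (Prod.ext_iff.1 hxy).2
    rw [Finset.card_image_of_injective _ hinj]
    have h1 := card_le_of_separated_subset_Icc hh (a := τ - p.1 - p.2 - δt) (b := τ - p.1 - p.2 + δt) (by linarith) (C p)
      (fun g hg => by
        rw [hC, Finset.mem_filter] at hg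
        have := abs_le.1 hg.2
        exact ⟨by linarith, by linarith⟩)
      (fun x hx y hy hxy => by
        rw [hC, Finset.mem_filter] at hx hy
        exact hsep x hx.1 y hy.1 hxy)
    have h2 : (τ - p.1 - p.2 + δt - (τ - p.1 - p.2 - δt)) / h + 1 = 2 * δt / h + 1 := by ring
    rwa [h2] at h1
  -- the pair count (part 5)
  set e : ℝ × ℝ → (Fin 2 → ℝ) := fun p => ![p.1, p.2] with he
  have he0 : ∀ p : ℝ × ℝ, e p 0 = p.1 := fun p => by rw [he]; simp
  have he1 : ∀ p : ℝ × ℝ, e p 1 = p.2 := fun p => by rw [he]; simp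
  have hWcard : (W.card : ℝ) * h ^ 2 ≤ 960 * A * (2 * δ' + (4 * B + 1) * h) / c ^ 2 := by
    rw [← Finset.card_image_of_injective W injective_pairVec]
    set ρ := 2 * ρ₀ + δt with hρ
    set ρ' := 2 * ρ₀ + δt + h / 2 with hρ'
    have hI : Icc (τ / 3 - 2 * ρ') (τ / 3 + 2 * ρ') ⊆ Icc (-Λ) Λ := by
      intro u hu
      obtain ⟨hu1, hu2⟩ := hu
      rw [hρ'] at hu1 hu2
      exact ⟨by linarith, by linarith⟩
    refine card_mul_sq_le_tripleSum_local hfm (τ := τ) (ρ := ρ) (ρ' := ρ') (β := β)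
      (fun u hu => hf u (hI hu)) (fun u hu => hf' u (hI hu)) (by rw [hρ]; positivity) hh (by rw [hρ, hρ']) hc hcA hB hδ'0
      (fun u hu => hfloor u (hI hu)) (fun u hu => hceil u (hI hu)) (fun u hu => hder u (hI hu)) _ ?_ ?_
    · -- separation in the sup distance
      intro x hx y hy hxy
      rw [Finset.mem_image] at hx hy
      obtain ⟨p, hp, rfl⟩ := hx
      obtain ⟨q, hq, rfl⟩ := hy
      rw [hW, Finset.mem_filter, Finset.mem_product] at hp hq
      have hpq : p ≠ q := fun h => hxy (by rw [h])
      rcases ne_or_eq p.1 q.1 with h1 | h1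
      · have hs := hsep p.1 hp.1.1 q.1 hq.1.1 h1
        calc h ≤ |p.1 - q.1| := hs
          _ = ‖(e p - e q) 0‖ := by rw [Real.norm_eq_abs, Pi.sub_apply, he0, he0]
          _ ≤ ‖e p - e q‖ := norm_le_pi_norm _ 0
          _ = dist (e p) (e q) := (dist_eq_norm _ _).symm
      · have h2 : p.2 ≠ q.2 := fun h2 => hpq (Prod.ext h1 h2)
        have hs := hsep p.2 hp.1.2 q.2 hq.1.2 h2
        calc h ≤ |p.2 - q.2| := hs
          _ = ‖(e p - e q) 1‖ := by rw [Real.norm_eq_abs, Pi.sub_apply, he1, he1]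
          _ ≤ ‖e p - e q‖ := norm_le_pi_norm _ 1
          _ = dist (e p) (e q) := (dist_eq_norm _ _).symm
    · -- in the sup ball about the diagonal point, and in the window
      intro x hx
      rw [Finset.mem_image] at hx
      obtain ⟨p, hp, rfl⟩ := hx
      rw [hW, Finset.mem_filter, Finset.mem_product] at hp
      obtain ⟨⟨hp1, hp2⟩, hwin⟩ := hp
      obtain ⟨ha1, ha2⟩ := hGabs p.1 hp1
      obtain ⟨hb1, hb2⟩ := hGabs p.2 hp2
      refine ⟨?_, ?_⟩
      · rw [Metric.mem_closedBall, dist_pi_le_iff (by rw [hρ]; positivity)]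
        intro i
        fin_cases i
        · show dist (e p 0) (τ / 3) ≤ ρ
          rw [he0, Real.dist_eq, hρ, abs_le]; constructor <;> linarith
        · show dist (e p 1) (τ / 3) ≤ ρ
          rw [he1, Real.dist_eq, hρ, abs_le]; constructor <;> linarith
      · simpa using hwin
  -- assemble
  have hWcard' : (W.card : ℝ) ≤ 960 * A * (2 * δ' + (4 * B + 1) * h) / c ^ 2 / h ^ 2 := by
    rw [le_div_iff₀ (pow_pos hh 2)]; exact hWcard
  calc (T.card : ℝ) ≤ ((W.biUnion fun p => (C p).image fun g => (p, g)).card : ℝ) := by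
        exact_mod_cast Finset.card_le_card hsub
    _ ≤ ∑ p ∈ W, (((C p).image fun g => (p, g)).card : ℝ) := by
        exact_mod_cast Finset.card_biUnion_le
    _ ≤ ∑ _p ∈ W, (2 * δt / h + 1) := Finset.sum_le_sum fun p _ => hCcard p
    _ = W.card * (2 * δt / h + 1) := by rw [Finset.sum_const, nsmul_eq_mul]
    _ ≤ (960 * A * (2 * δ' + (4 * B + 1) * h) / c ^ 2 / h ^ 2) * (2 * δt / h + 1) :=
        mul_le_mul_of_nonneg_right hWcard' (by positivity)
    _ = (2 * δt / h + 1) * (960 * A * (2 * (δn + B * δt) + (4 * B + 1) * h) / c ^ 2 / h ^ 2) := by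
        rw [hδ', mul_comm]

end Summit.HubbardSuperconductivity.HubbardSuperconductivity.Theorems.ThinLevelSet

end
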